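import Literature.Topology.FourManifolds.SphereSurgeryHomology
import Literature.Topology.FourManifolds.SphereFamilySurgeryExistence
import Literature.Topology.FourManifolds.HCobordismWallDuality
import Literature.AlgebraicTopology.SingularHomology.LefschetzDualityProofs
import Literature.AlgebraicTopology.SingularHomology.GysinMapSupportProofs
import Literature.AlgebraicTopology.SingularHomology.UniversalCoefficientsProofs
import Literature.AlgebraicTopology.SingularHomology.KroneckerInjective
import Literature.AlgebraicTopology.SingularHomology.ExcisionMayerVietorisProofs
import HarnessLib

/-!
# A sphere class generating a free direct summand is primitive (Kervaire–Milnor 1963, proof of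
# Lemma 5.7: "Using the Poincaré duality theorem one sees that … `λ` is primitive")

Topic `Literature/Topology/FourManifolds`; a brick for the decomposition child
`Literature.Topology.FourManifolds.HomotopySphere.boundsContractible_of_nullCobordism_isStablyParallelizable_four`
(M. Kervaire, J. Milnor, *Groups of homotopy spheres I*, Ann. of Math. (2) 77 (1963), Thm. 5.1 at
`k = 2`), through its reduction `…_of_surgeryLemmas''` (`ThetaFourKervaireMilnorSurgeryProofs.lean`),
whose hypothesis `hdual` is the statement proved here.

Kervaire–Milnor, p. 516 (the **Hypothesis**: `M` compact, s-parallelizable, of dimension `2k + 1`,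
`(k-1)`-connected, `bM` a homology sphere; the **Assertion**: "`H_kM'` is obtained from `H_kM` by
dividing by `λ(Z)` provided `λ` is *primitive*, i.e. there is `μ ∈ H_{k+1}M` with `μ · λ = 1`";
and the proof of **Lemma 5.7**): *"Let `λ` generate one of the infinite cyclic summands of
`H_kM`. Using the Poincaré duality theorem (for the pairing `H_{k+1}(M, bM) ⊗ H_kM → Z`) one sees
that there exists `μ₁ ∈ H_{k+1}(M, bM)` with `μ₁ · λ = 1`. Since `H_k(bM) = 0`, the homomorphism
`H_{k+1}M → H_{k+1}(M, bM)` is onto, hence `μ₁` lifts to `μ ∈ H_{k+1}M` with `μ · λ = 1`. Thus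
`λ` is primitive, and can be killed by a modification."*

In the tree primitivity of the core `S = φ(Sᵏ × 0)` of a framed sphere `φ` is the homological
condition actually used by the surgery lemmas (`SphereSurgeryHandleMeridian.lean`,
`SphereSurgeryOddMiddleHomology.lean`): **`j⁎ : H_{k+1}(M) → H_{k+1}(M, M ∖ S)` is onto** (the
intersection number `μ · λ` being the image of `μ` in `H_{k+1}(M | S) ≅ ℤ`). This file PROVES it
from "`λ` generates a free direct summand" (a homomorphism `f : H_kM → ℤ` with `f(λ) = 1`),
`H_k(bM) = 0` and simple connectivity of `M` (orientability), following the printed sentence with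
the tree's duality theorems:

* `M` simply connected and compact with boundary has a relative fundamental class
  `z ∈ H_{n+1}(M, bM; ℤ)` (`exists_isRelFundamentalClass_of_simplyConnectedSpace`, Hatcher Prop.
  3.25 and p. 253); universal coefficients give `α ∈ Hᵏ(M; ℤ)` with `⟨α, -⟩ = f`
  (`kroneckerPairing_surjective`, Hatcher Thm. 3.2); `μ₁ = α ⌢ z ∈ H_{k+1}(M, bM)` (the duality
  class; Lefschetz duality `LefschetzDualityProofs.lean`, Spanier Thm. 6.3.12);
* `H_k(bM) = 0` makes `H_{k+1}M → H_{k+1}(M, bM)` onto (exact sequence of the pair);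
* **`μ₁ · λ = ⟨α, λ⟩ = 1`**: the image of `α ⌢ z` in `H_{k+1}(M | S)`, read in the external collar
  `X = M ∪ bM × (-∞, 0]` (`ExternalCollar*.lean`, Hatcher p. 253), is the Čech cap product
  `α|_S ⌢ [X]_S` (`ExtCollar.relCapProduct_eq_toExtCollar_inv`, the projection formula
  `relativeSingularHomology.map_relCapProduct`, `cechCap_of_univ_thetaInv`,
  `ExtCollar.classAlong_orientation_eq`), and `- ⌢ [X]_S : Ȟᵏ(S) → H_{k+1}(X | S)` is bijective —
  Čech–Alexander–Poincaré duality along the compact `S`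
  (`HomologicalOrientation.bijective_cechCap_classAlong`, Miller Thm. 37.1); finally `Ȟᵏ(S) = Hᵏ(S)`
  (`S ≅ Sᵏ` is taut in `X`: the tubes `φ(Sᵏ × εB)` retract onto it, `Cech.RetractionNhds`,
  Spanier Thm. 6.1.10) is `ℤ`, detected by `⟨-, [Sᵏ]⟩` (`kroneckerPairing_injective_of_isZero`),
  and `⟨α|_S, [S]⟩ = ⟨α, λ⟩ = f(λ) = 1`, so `α|_S` generates `Ȟᵏ(S)` and the image of
  `H_{k+1}(M, bM)` is all of `H_{k+1}(M | S)`.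

Main results: `FramedSphereFamily.exists_ofAbsolute_eq_zsmul_of_exists_dual` — the computation
"`μ₁ · λ = d`" for any value `d = f(λ)` of the functional: `d • H_{l+1}(M, M ∖ S)` lies in the image of
`H_{l+1}(M)`; and its case `d = 1`,
`FramedSphereFamily.epi_ofAbsolute_complement_of_exists_dual` — for a framed sphere
`ν : Sᵏ × ℝˡ⁺¹ ↪ M` (`k + l = n`, `M` compact simply connected smooth `(n+1)`-manifold with
boundary, `k ≥ 2`), a generator `θ` of `H_k(Sᵏ; ℤ)`, `λ = (ν.sphereMap)⁎ θ`: if `H_l(bM; ℤ) = 0` and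
`f(λ) = 1` for some homomorphism `f : H_k(M; ℤ) → ℤ`, then
`H_{l+1}(M; ℤ) → H_{l+1}(M, M ∖ S; ℤ)` is onto. Everything is proved; no definitions, no named facts.

## References

* M. Kervaire, J. Milnor, *Groups of homotopy spheres I*, Ann. of Math. (2) 77 (1963), p. 516
  (Hypothesis, Assertion, proof of Lemma 5.7). doi:10.2307/1970128 [KervaireMilnorAnnals1963]
* A. Hatcher, *Algebraic Topology*, CUP 2002, §3.1 Thm. 3.2, §3.3 Prop. 3.25, Lemma 3.27, p. 241,
  p. 253, Thm. 3.43, Thm. 3.44. [HatcherAT2002]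
* H. Miller, *Lectures on Algebraic Topology*, World Scientific 2020, Thm. 37.1, Lemma 34.5.
  [Miller2020]
* E. H. Spanier, *Algebraic Topology*, Springer 1981, Ch. 6 §1 Thm. 10, §3 Thm. 12. [Spanier1981]
-/

noncomputable section

open scoped Manifold ContDiff Topology
open Set Function CategoryTheory CategoryTheory.Limits AddSubgroup Topology
open Literature.AlgebraicTopology.SingularHomology

namespace Literature.Topology.FourManifolds

/-- Local notation: `𝔼 n` is the model Euclidean space `EuclideanSpace ℝ (Fin n)`. -/
local notation "𝔼 " n:arg => EuclideanSpace ℝ (Fin n)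

/-- Local notation: `𝕊 n` is the unit sphere in `EuclideanSpace ℝ (Fin (n + 1))`. -/
local notation "𝕊 " n:arg => (Metric.sphere (0 : EuclideanSpace ℝ (Fin (n + 1))) 1)

/-! ### Čech classes of a taut `k`-sphere are detected by the Kronecker pairing -/

/-- **Čech classes of a taut subset `K ≅ Sᵏ` (`k ≥ 2`) are detected by the Kronecker pairing**:
if `L : Ȟᵏ(K) → ℤ` is `b ↦ ⟨e^* b|_K, θ⟩` for a homeomorphism `e : Sᵏ ≅ K` and a generator `θ` of
`H_k(Sᵏ; ℤ)`, then `L b = 0` forces `b = 0` (`Ȟᵏ(K) → Hᵏ(K)` is bijective by tautness, Spanier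
Thm. 6.1.10; `e^*` is an isomorphism; `Hᵏ(Sᵏ; ℤ) → Hom(H_k(Sᵏ), ℤ)` is injective since
`H_{k-1}(Sᵏ) = 0`, Hatcher Thm. 3.2; and `H_k(Sᵏ) = ℤθ`). [cite: Spanier1981, Ch. 6 §1, Thm. 10] [cite: HatcherAT2002, §3.1 Thm. 3.2] -/
theorem Cech.eq_zero_of_sphere {X : Type} [TopologicalSpace X] {K : Set X} {k : ℕ}
    (T : Cech.RetractionNhds K) (hk : 2 ≤ k) (e : (𝕊 k) ≃ₜ ↥K)
    {θ : singularHomology ℤ ℤ (𝕊 k) k} (hθ : zmultiples θ = ⊤)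
    (L : Cech ℤ (ModuleCat.of ℤ (ULift.{0} ℤ)) K k → ℤ)
    (hL : ∀ b, L b = kroneckerPairing ℤ ℤ (𝕊 k) k
      (singularCohomology.map ℤ ℤ (e : C(𝕊 k, ↥K)) k (Cech.toSingularCohomology ℤ K k b)) θ)
    {b : Cech ℤ (ModuleCat.of ℤ (ULift.{0} ℤ)) K k} (hb : L b = 0) : b = 0 := by
  rw [hL] at hb
  set c := singularCohomology.map ℤ ℤ (e : C(𝕊 k, ↥K)) k (Cech.toSingularCohomology ℤ K k b)
    with hc
  -- `⟨c, -⟩ = 0` on `H_k(Sᵏ) = ℤ θ`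
  have h1 : kroneckerPairing ℤ ℤ (𝕊 k) k c = 0 := by
    ext x
    obtain ⟨m, rfl⟩ := mem_zmultiples_iff.1 (hθ.symm ▸ mem_top x : x ∈ zmultiples θ)
    rw [map_zsmul, hb, smul_zero, LinearMap.zero_apply]
  -- the Kronecker map is injective on `Hᵏ(Sᵏ)`
  obtain ⟨j, rfl⟩ : ∃ j, k = j + 1 := ⟨k - 1, by omega⟩
  have h2 : c = 0 :=
    kroneckerPairing_injective_of_isZero (R := ℤ) (X := 𝕊 (j + 1)) j
      (isZero_singularHomology_sphere_holds ℤ ℤ (by omega) (by omega)) (by rw [h1, map_zero])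
  -- `e^*` is injective, and so is `Ȟ → H`
  have h3 : Cech.toSingularCohomology ℤ K (j + 1) b = 0 := by
    have hi : Function.Injective (singularCohomology.map ℤ ℤ (e : C(𝕊 (j + 1), ↥K)) (j + 1)) :=
      ((forget (ModuleCat ℤ)).mapIso (singularCohomology.mapIso ℤ ℤ e (j + 1))).toEquiv.injective
    exact hi (by rw [map_zero]; exact h2)
  exact (T.bijective_toSingularCohomology (R := ℤ) (j + 1)).1 (by rw [map_zero]; exact h3)

/-- **`d • b = (L b) • a` when `L a = d`**, for the Kronecker functional `L` of a taut `K ≅ Sᵏ`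
(`Cech.eq_zero_of_sphere` applied to `d • b - (L b) • a`, on which the additive `L` vanishes).
[cite: Spanier1981, Ch. 6 §1, Thm. 10] -/
theorem Cech.zsmul_eq_zsmul_of_sphere {X : Type} [TopologicalSpace X] {K : Set X} {k : ℕ}
    (T : Cech.RetractionNhds K) (hk : 2 ≤ k) (e : (𝕊 k) ≃ₜ ↥K)
    {θ : singularHomology ℤ ℤ (𝕊 k) k} (hθ : zmultiples θ = ⊤)
    (L : Cech ℤ (ModuleCat.of ℤ (ULift.{0} ℤ)) K k → ℤ)
    (hL : ∀ b, L b = kroneckerPairing ℤ ℤ (𝕊 k) k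
      (singularCohomology.map ℤ ℤ (e : C(𝕊 k, ↥K)) k (Cech.toSingularCohomology ℤ K k b)) θ)
    {a : Cech ℤ (ModuleCat.of ℤ (ULift.{0} ℤ)) K k} {d : ℤ} (ha : L a = d)
    (b : Cech ℤ (ModuleCat.of ℤ (ULift.{0} ℤ)) K k) : d • b = L b • a := by
  have hLsub : ∀ (b b' : Cech ℤ (ModuleCat.of ℤ (ULift.{0} ℤ)) K k) (m m' : ℤ),
      L (m • b - m' • b') = m * L b - m' * L b' := by
    intro b b' m m'
    rw [hL, hL, hL, map_sub, map_zsmul, map_zsmul, map_sub, map_zsmul, map_zsmul, map_sub, map_zsmul,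
      map_zsmul, LinearMap.sub_apply, LinearMap.smul_apply, LinearMap.smul_apply, smul_eq_mul, smul_eq_mul]
  have h := Cech.eq_zero_of_sphere T hk e hθ L hL (b := d • b - L b • a)
    (by rw [hLsub, ha, mul_comm, sub_self])
  rwa [sub_eq_zero] at h

/-- **A Čech class of a taut subset `K ≅ Sᵏ` (`k ≥ 2`) is the multiple of any class pairing to `1`
with the fundamental class**: with `L` as above and `L a = 1`, `b = (L b) • a` for every `b`.
[cite: Spanier1981, Ch. 6 §1, Thm. 10] [cite: HatcherAT2002, §3.1 Thm. 3.2] -/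
theorem Cech.eq_zsmul_of_sphere {X : Type} [TopologicalSpace X] {K : Set X} {k : ℕ}
    (T : Cech.RetractionNhds K) (hk : 2 ≤ k) (e : (𝕊 k) ≃ₜ ↥K)
    {θ : singularHomology ℤ ℤ (𝕊 k) k} (hθ : zmultiples θ = ⊤)
    (L : Cech ℤ (ModuleCat.of ℤ (ULift.{0} ℤ)) K k → ℤ)
    (hL : ∀ b, L b = kroneckerPairing ℤ ℤ (𝕊 k) k
      (singularCohomology.map ℤ ℤ (e : C(𝕊 k, ↥K)) k (Cech.toSingularCohomology ℤ K k b)) θ)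
    {a : Cech ℤ (ModuleCat.of ℤ (ULift.{0} ℤ)) K k} (ha : L a = 1)
    (b : Cech ℤ (ModuleCat.of ℤ (ULift.{0} ℤ)) K k) : b = L b • a := by
  simpa only [one_smul] using Cech.zsmul_eq_zsmul_of_sphere T hk e hθ L hL ha b

namespace FramedSphereFamily

open ExtCollar

variable {n k l : ℕ} {W : Type} [TopologicalSpace W] [ChartedSpace (EuclideanHalfSpace (n + 1)) W]
  (ν : FramedSphereFamily (𝓡∂ (n + 1)) W Unit k (l + 1))

/-! ### The core sphere in the external collar -/

/-- The cores of a framed family miss the boundary. [cite: Kosinski1993, Ch. X §2, p. 201] -/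
theorem disjoint_cores_boundary [IsManifold (𝓡∂ (n + 1)) ∞ W] (hkl : k + l = n) :
    Disjoint ν.cores ((𝓡∂ (n + 1)).boundary W) := by
  refine Set.disjoint_left.2 fun x hx hb => ?_
  obtain ⟨i, v, rfl⟩ := ν.mem_cores_iff.1 hx
  exact ν.apply_not_mem_boundary hkl i (v, 0) hb

/-- The union of the cores is compact. [folklore] -/
theorem isCompact_cores : IsCompact ν.cores :=
  isCompact_iUnion fun i => isCompact_range (ν.continuous_sphere i)

/-- For `V` disjoint from `∂W`, `incl V = base⁻¹ V` in the external collar. [folklore] -/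
theorem image_incl_eq_preimage_base {V : Set W} (hV : Disjoint V ((𝓡∂ (n + 1)).boundary W)) :
    incl n '' V = (base : ExtCollar n W → W) ⁻¹' V := by
  ext x
  refine ⟨?_, fun hx => ⟨base x, hx, incl_base_of_height_eq_zero
    (height_eq_zero_of_base_not_mem fun h => Set.disjoint_left.1 hV hx h)⟩⟩
  rintro ⟨v, hv, rfl⟩
  exact hv

/-- For `V` open and disjoint from `∂W`, `incl V` is open in the external collar. [folklore] -/
theorem isOpen_image_incl {V : Set W} (hVo : IsOpen V) (hV : Disjoint V ((𝓡∂ (n + 1)).boundary W)) :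
    IsOpen (incl n '' V) := by
  rw [image_incl_eq_preimage_base hV]
  exact hVo.preimage continuous_base

/-- A point of the external collar whose base point lies on a core is the image of that point.
[folklore] -/
theorem eq_incl_of_base_mem_cores [IsManifold (𝓡∂ (n + 1)) ∞ W] (hkl : k + l = n)
    {x : ExtCollar n W} (hx : base x ∈ ν.cores) : x = incl n (base x) :=
  (incl_base_of_height_eq_zero (height_eq_zero_of_base_not_mem fun h =>
    Set.disjoint_left.1 (ν.disjoint_cores_boundary hkl) hx h)).symm

/-- `incl` maps `W ∖ S` into `X ∖ incl S`. [folklore] -/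
theorem mapsTo_incl_compl_cores : MapsTo (incl n) ν.coresᶜ (incl n '' ν.cores)ᶜ :=
  fun _ hx ⟨_, hy, hxy⟩ => hx (incl_injective hxy ▸ hy)

/-- `base` maps `X ∖ incl S` into `W ∖ S`. [folklore] -/
theorem mapsTo_base_compl_cores [IsManifold (𝓡∂ (n + 1)) ∞ W] (hkl : k + l = n) :
    MapsTo (base : ExtCollar n W → W) (incl n '' ν.cores)ᶜ ν.coresᶜ :=
  fun x hx hb => hx ⟨base x, hb, (ν.eq_incl_of_base_mem_cores hkl hb).symm⟩

/-- The vertical squeeze preserves `X ∖ incl S`. [folklore] -/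
theorem mapsTo_squeeze_compl_cores [IsManifold (𝓡∂ (n + 1)) ∞ W] (hkl : k + l = n) (s : ℝ) :
    MapsTo (ExtCollar.squeeze s) (incl n '' ν.cores)ᶜ (incl n '' ν.cores : Set (ExtCollar n W))ᶜ := by
  intro x hx hsx
  obtain ⟨y, hy, hyx⟩ := hsx
  have hb : base x = y := by rw [← ExtCollar.base_squeeze s x, ← hyx, base_incl]
  exact hx ⟨y, hy, by rw [← hb]; exact (ν.eq_incl_of_base_mem_cores hkl (hb ▸ hy)).symm⟩

/-- **`incl⁎ : H_q(W, W ∖ S) ≅ H_q(X, X ∖ incl S)`** for the cores `S` of a framed family and the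
external collar `X` of `W` (`ExtCollar.isIso_map_incl`: `X ∖ incl S` retracts vertically).
[cite: HatcherAT2002, §3.3 pp. 253–254] -/
theorem isIso_map_incl_compl_cores [IsManifold (𝓡∂ (n + 1)) ∞ W] (hkl : k + l = n) (q : ℕ) :
    IsIso (relativeSingularHomology.map ℤ ℤ (inclCM n) ν.mapsTo_incl_compl_cores q) :=
  ExtCollar.isIso_map_incl ℤ ℤ ν.mapsTo_incl_compl_cores (ν.mapsTo_base_compl_cores hkl)
    (ν.mapsTo_squeeze_compl_cores hkl) q

/-- `∂W ⊆ W ∖ S`. [cite: Kosinski1993, Ch. X §2, p. 201] -/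
theorem mapsTo_id_boundary_compl_cores [IsManifold (𝓡∂ (n + 1)) ∞ W] (hkl : k + l = n) :
    MapsTo (ContinuousMap.id W) ((𝓡∂ (n + 1)).boundary W) ν.coresᶜ :=
  fun _ hx hxS => Set.disjoint_left.1 (ν.disjoint_cores_boundary hkl) hxS hx

/-- The closed collar misses `incl S`. [folklore] -/
theorem mapsTo_id_closedCollar_compl_cores [IsManifold (𝓡∂ (n + 1)) ∞ W] (hkl : k + l = n) :
    MapsTo (ContinuousMap.id (ExtCollar n W)) (closedCollar : Set (ExtCollar n W)) (incl n '' ν.cores)ᶜ := by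
  intro x hx hxS
  obtain ⟨y, hy, hyx⟩ := hxS
  rw [ContinuousMap.id_apply] at hyx
  subst hyx
  have hb := (mem_closedCollar_iff _).1 hx
  rw [base_incl] at hb
  exact Set.disjoint_left.1 (ν.disjoint_cores_boundary hkl) hy hb

/-- **Naturality square**: `incl⁎ (j_S w) = (toExtCollar w)|_{incl S}` for `w ∈ H_q(W, ∂W)`, where
`j_S : H_q(W, ∂W) → H_q(W, W ∖ S)`. [folklore] -/
theorem map_incl_map_id_eq_restrictLocal [T2Space W] [IsManifold (𝓡∂ (n + 1)) ∞ W] (hkl : k + l = n)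
    (q : ℕ) (w : relativeSingularHomology ℤ ℤ W ((𝓡∂ (n + 1)).boundary W) q) :
    relativeSingularHomology.map ℤ ℤ (inclCM n) ν.mapsTo_incl_compl_cores q
        (relativeSingularHomology.map ℤ ℤ (ContinuousMap.id W) (ν.mapsTo_id_boundary_compl_cores hkl) q w) =
      restrictLocal ℤ ℤ (image_subset_range (incl n) ν.cores) q ((toExtCollar ℤ ℤ q).hom w) := by
  have hincl : MapsTo (inclCM n) ((𝓡∂ (n + 1)).boundary W) (incl n '' ν.cores : Set (ExtCollar n W))ᶜ :=
    ν.mapsTo_incl_compl_cores.comp (ν.mapsTo_id_boundary_compl_cores hkl)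
  -- left-hand side: one map of pairs `incl : (W, ∂W) → (X, X ∖ incl S)`
  rw [← ModuleCat.comp_apply, ← relativeSingularHomology.map_comp,
    relativeSingularHomology.map_congr ℤ ℤ (ContinuousMap.comp_id (inclCM n)) _ hincl q]
  -- right-hand side: factor the restriction through `(X, C)`
  have hfac : restrictLocal ℤ ℤ (image_subset_range (incl n) ν.cores) q =
      relativeSingularHomology.map ℤ ℤ (ContinuousMap.id (ExtCollar n W)) mapsTo_id_compl_closedCollar q ≫
        relativeSingularHomology.map ℤ ℤ (ContinuousMap.id (ExtCollar n W))
          (ν.mapsTo_id_closedCollar_compl_cores hkl) q := by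
    rw [← relativeSingularHomology.map_comp]
    rfl
  rw [hfac, ModuleCat.comp_apply, map_id_toExtCollar, ← ModuleCat.comp_apply,
    ← relativeSingularHomology.map_comp,
    relativeSingularHomology.map_congr ℤ ℤ (ContinuousMap.id_comp (inclCM n)) _ hincl q]

/-! ### The core `incl S ≅ Sᵏ` is taut in the external collar -/

/-- **`Sᵏ ≅ incl S`**: the core of a framed sphere, pushed into the external collar, is a
homeomorphic copy of `Sᵏ` (a continuous bijection from a compact space to a Hausdorff space).
[folklore] -/
theorem exists_homeomorph_sphere_image_cores [T2Space W] :
    ∃ e : (𝕊 k) ≃ₜ ↥(incl n '' ν.cores : Set (ExtCollar n W)),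
      ∀ u, ((e u : ↥(incl n '' ν.cores)) : ExtCollar n W) = incl n (ν.toFun () (u, 0)) := by
  have hmem : ∀ u : 𝕊 k, incl n (ν.toFun () (u, 0)) ∈ incl n '' ν.cores :=
    fun u => ⟨_, ν.mem_cores_iff.2 ⟨(), u, rfl⟩, rfl⟩
  let g : (𝕊 k) → ↥(incl n '' ν.cores : Set (ExtCollar n W)) :=
    fun u => ⟨incl n (ν.toFun () (u, 0)), hmem u⟩
  have hg : Continuous g :=
    (continuous_incl.comp ((ν.continuous ()).comp (continuous_id.prodMk continuous_const))).subtype_mk _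
  have hinj : Injective g := fun u v h => by
    have h1 := ν.injective () (incl_injective (congrArg Subtype.val h))
    exact (Prod.ext_iff.1 h1).1
  have hsurj : Surjective g := by
    rintro ⟨x, y, hy, rfl⟩
    obtain ⟨i, v, rfl⟩ := ν.mem_cores_iff.1 hy
    exact ⟨v, rfl⟩
  exact ⟨Continuous.homeoOfEquivCompactToT2 (f := Equiv.ofBijective g ⟨hinj, hsurj⟩) hg, fun u => rfl⟩

/-- **The core `incl S` is taut in the external collar** (a tautness datum in the sense of
Spanier 1966, Thm. 6.1.10: the tube `incl φ(Sᵏ × ℝˡ⁺¹)` retracts onto the core along the fibres,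
and every neighbourhood of the core contains a tube `incl φ(Sᵏ × εBˡ⁺¹)` (tube lemma) deforming
radially onto the core inside it). [cite: Spanier1981, Ch. 6 §1, Thm. 10] -/
theorem nonempty_retractionNhds_image_cores [IsManifold (𝓡∂ (n + 1)) ∞ W] (hkl : k + l = n) :
    Nonempty (Cech.RetractionNhds (incl n '' ν.cores : Set (ExtCollar n W))) := by
  have hφ : IsEmbedding (ν.toFun ()) := (ν.isOpenEmbedding_toFun ()).isEmbedding
  have hdisj : Disjoint (range (ν.toFun ())) ((𝓡∂ (n + 1)).boundary W) :=
    Set.disjoint_left.2 (by rintro _ ⟨q, rfl⟩ hb; exact ν.apply_not_mem_boundary hkl () q hb)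
  have hU₀ : incl n '' range (ν.toFun ()) = (base : ExtCollar n W → W) ⁻¹' range (ν.toFun ()) :=
    image_incl_eq_preimage_base hdisj
  have hSU : incl n '' ν.cores ⊆ incl n '' range (ν.toFun ()) := by
    refine image_mono fun x hx => ?_
    obtain ⟨i, v, rfl⟩ := ν.mem_cores_iff.1 hx
    exact ⟨(v, 0), rfl⟩
  -- the tube coordinates on `U₀ = incl φ(Sᵏ × ℝˡ⁺¹)`
  let eφ := hφ.toHomeomorph
  have heφ : ∀ q, (eφ q : W) = ν.toFun () q := fun q => rfl
  have hbase : ∀ x : ↥(incl n '' range (ν.toFun ())), base (x : ExtCollar n W) ∈ range (ν.toFun ()) := by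
    intro x
    have hx : (x : ExtCollar n W) ∈ (base : ExtCollar n W → W) ⁻¹' range (ν.toFun ()) := by
      rw [← hU₀]
      exact x.2
    exact hx
  let qq : ↥(incl n '' range (ν.toFun ())) → (𝕊 k) × 𝔼 (l + 1) := fun x => eφ.symm ⟨base x.1, hbase x⟩
  have hqq : Continuous qq :=
    eφ.symm.continuous.comp ((continuous_base.comp continuous_subtype_val).subtype_mk _)
  have hqq_incl : ∀ q hq, qq ⟨incl n (ν.toFun () q), hq⟩ = q := by
    intro q hq
    change eφ.symm ⟨base (incl n (ν.toFun () q)), _⟩ = q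
    rw [Homeomorph.symm_apply_eq]
    ext1
    change base (incl n (ν.toFun () q)) = (eφ q : W)
    rw [base_incl, heφ]
  have hincl_qq : ∀ x : ↥(incl n '' range (ν.toFun ())), incl n (ν.toFun () (qq x)) = x := by
    intro x
    have h1 : (eφ (qq x) : W) = base x.1 := by simp only [qq, Homeomorph.apply_symm_apply]
    rw [heφ] at h1
    rw [h1]
    exact incl_base_of_height_eq_zero (height_eq_zero_of_base_not_mem fun h =>
      Set.disjoint_left.1 hdisj (hbase x) h)
  -- the retraction `incl φ(u, w) ↦ incl φ(u, 0)`
  have hmemS : ∀ u : 𝕊 k, incl n (ν.toFun () (u, 0)) ∈ incl n '' ν.cores :=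
    fun u => ⟨_, ν.mem_cores_iff.2 ⟨(), u, rfl⟩, rfl⟩
  let r : C(↥(incl n '' range (ν.toFun ())), ↥(incl n '' ν.cores : Set (ExtCollar n W))) :=
    ⟨fun x => ⟨incl n (ν.toFun () ((qq x).1, 0)), hmemS _⟩,
      (continuous_incl.comp ((ν.continuous ()).comp
        ((continuous_fst.comp hqq).prodMk continuous_const))).subtype_mk _⟩
  have hr : ∀ x, (r x : ExtCollar n W) = incl n (ν.toFun () ((qq x).1, 0)) := fun x => rfl
  refine ⟨⟨incl n '' range (ν.toFun ()), isOpen_image_incl (ν.isOpen_range ()) hdisj, hSU, r, ?_, ?_⟩⟩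
  · -- `r` fixes the core
    intro x hx
    obtain ⟨y, hy, hyx⟩ := hx
    obtain ⟨i, v, rfl⟩ := ν.mem_cores_iff.1 hy
    subst hyx
    ext1
    rw [hr]
    change incl n (ν.toFun () ((qq ⟨incl n (ν.toFun () (v, 0)), _⟩).1, 0)) = incl n (ν.toFun () (v, 0))
    rw [hqq_incl]
  · -- small tubes deform onto the core inside any neighbourhood
    intro U hUo hSU' hUU₀
    have hO : IsOpen ((fun q => incl n (ν.toFun () q)) ⁻¹' U) :=
      hUo.preimage (continuous_incl.comp (ν.continuous ()))
    have hO0 : (univ : Set (𝕊 k)) ×ˢ ({0} : Set (𝔼 (l + 1))) ⊆ (fun q => incl n (ν.toFun () q)) ⁻¹' U := by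
      rintro ⟨u, w⟩ ⟨-, hw⟩
      rw [mem_singleton_iff] at hw
      subst hw
      exact hSU' (hmemS u)
    obtain ⟨A, B, -, hB, hAu, hB0, hAB⟩ :=
      generalized_tube_lemma isCompact_univ isCompact_singleton hO hO0
    obtain ⟨ε, hε, hεB⟩ := Metric.isOpen_iff.1 hB 0 (hB0 rfl)
    -- `V = incl φ(Sᵏ × εB)`
    set V : Set (ExtCollar n W) :=
      (fun q => incl n (ν.toFun () q)) '' (univ ×ˢ Metric.ball (0 : 𝔼 (l + 1)) ε) with hV
    have hVo : IsOpen V := by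
      have h1 : V = incl n '' (ν.toFun () '' (univ ×ˢ Metric.ball (0 : 𝔼 (l + 1)) ε)) := by
        rw [hV, image_image]
      rw [h1]
      exact isOpen_image_incl ((ν.isOpenEmbedding_toFun ()).isOpenMap _
        (isOpen_univ.prod Metric.isOpen_ball)) (Set.disjoint_of_subset_left (image_subset_range _ _) hdisj)
    have hSV : incl n '' ν.cores ⊆ V := by
      rintro _ ⟨y, hy, rfl⟩
      obtain ⟨i, v, rfl⟩ := ν.mem_cores_iff.1 hy
      exact ⟨(v, 0), ⟨mem_univ _, Metric.mem_ball_self hε⟩, rfl⟩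
    have hVU : V ⊆ U := by
      rintro _ ⟨q, hq, rfl⟩
      exact hAB ⟨hAu (mem_univ _), hεB hq.2⟩
    have hVU₀ : V ⊆ incl n '' range (ν.toFun ()) := hVU.trans hUU₀
    have hqV : ∀ x (hx : x ∈ V), (qq ⟨x, hVU₀ hx⟩).2 ∈ Metric.ball (0 : 𝔼 (l + 1)) ε := by
      rintro _ ⟨q₀, hq₀, rfl⟩
      rw [hqq_incl]
      exact hq₀.2
    -- the radial homotopy `(t, incl φ(u, w)) ↦ incl φ(u, (1 - t) w)`
    have hsm : ∀ (t : unitInterval) (x : ↥V),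
        incl n (ν.toFun () ((qq ⟨x.1, hVU₀ x.2⟩).1, (1 - (t : ℝ)) • (qq ⟨x.1, hVU₀ x.2⟩).2)) ∈ U := by
      intro t x
      refine hAB ⟨hAu (mem_univ _), hεB ?_⟩
      have hw := hqV x.1 x.2
      rw [Metric.mem_ball, dist_zero_right] at hw ⊢
      calc ‖(1 - (t : ℝ)) • (qq ⟨x.1, hVU₀ x.2⟩).2‖ = |1 - (t : ℝ)| * ‖(qq ⟨x.1, hVU₀ x.2⟩).2‖ :=
            norm_smul _ _
        _ ≤ 1 * ‖(qq ⟨x.1, hVU₀ x.2⟩).2‖ := by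
            refine mul_le_mul_of_nonneg_right (abs_le.2 ⟨?_, ?_⟩) (norm_nonneg _) <;>
              linarith [unitInterval.nonneg t, unitInterval.le_one t]
        _ < ε := by rw [one_mul]; exact hw
    refine ⟨V, hVo, hSV, hVU, ⟨{
      toFun := fun tx => ⟨incl n (ν.toFun () ((qq ⟨tx.2.1, hVU₀ tx.2.2⟩).1,
          (1 - (tx.1 : ℝ)) • (qq ⟨tx.2.1, hVU₀ tx.2.2⟩).2)), hsm tx.1 tx.2⟩
      continuous_toFun := ?_
      map_zero_left := ?_
      map_one_left := ?_ }⟩⟩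
    · refine Continuous.subtype_mk (continuous_incl.comp ((ν.continuous ()).comp ?_)) _
      have hq2 : Continuous fun tx : unitInterval × ↥V => qq ⟨tx.2.1, hVU₀ tx.2.2⟩ :=
        hqq.comp ((continuous_subtype_val.comp continuous_snd).subtype_mk _)
      exact (continuous_fst.comp hq2).prodMk
        (((continuous_const.sub (continuous_subtype_val.comp continuous_fst))).smul
          (continuous_snd.comp hq2))
    · intro x
      ext1
      change incl n (ν.toFun () ((qq ⟨x.1, hVU₀ x.2⟩).1,
        (1 - ((0 : unitInterval) : ℝ)) • (qq ⟨x.1, hVU₀ x.2⟩).2)) = x.1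
      rw [Set.Icc.coe_zero, sub_zero, one_smul, Prod.mk.eta, hincl_qq]
    · intro x
      ext1
      change incl n (ν.toFun () ((qq ⟨x.1, hVU₀ x.2⟩).1,
        (1 - ((1 : unitInterval) : ℝ)) • (qq ⟨x.1, hVU₀ x.2⟩).2)) = (r ⟨x.1, hUU₀ (hVU x.2)⟩ : ExtCollar n W)
      rw [Set.Icc.coe_one, sub_self, zero_smul, hr]

/-! ### The duality class `α ⌢ z` localised at the core is the Čech cap product `α|_S ⌢ [X]_S` -/

/-- **`(α ⌢ z)|_S = α|_S ⌢ [X]_S`** read in the external collar: for a relative fundamental class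
`z` of `(W, ∂W)`, `α ∈ Hᵖ(W)` and the cores `S`, the image of `α ⌢ z ∈ H_q(W, ∂W)` in
`H_q(X | incl S)` (concrete model) is the Čech cap product of `Θ⁻¹(base^* α)` with the fundamental
class `[X]_{incl S}` of the orientation of `X` defined by `z` (projection formula, Hatcher p. 241;
Miller 2020, §34; `ExtCollar.classAlong_orientation_eq`). [cite: HatcherAT2002, §3.3 p. 241] [cite: Miller2020, §34, Def. 34.4] -/
theorem concreteIso_map_incl_relCapProduct [T2Space W] [CompactSpace W] [IsManifold (𝓡∂ (n + 1)) ∞ W]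
    (hkl : k + l = n) {p q : ℕ} (h : p + q = n + 1)
    (z : relativeSingularHomology ℤ ℤ W ((𝓡∂ (n + 1)).boundary W) (n + 1))
    (hz : IsRelFundamentalClass ℤ ((𝓡∂ (n + 1)).boundary W) z) (α : singularCohomology ℤ ℤ W p) :
    (relativeSingularHomology.concreteIso ℤ ℤ (ExtCollar n W) (incl n '' ν.cores)ᶜ q).hom
        (relativeSingularHomology.map ℤ ℤ (inclCM n) ν.mapsTo_incl_compl_cores q
          (relativeSingularHomology.map ℤ ℤ (ContinuousMap.id W) (ν.mapsTo_id_boundary_compl_cores hkl) q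
            (relCapProduct (M := ℤ) ((𝓡∂ (n + 1)).boundary W) h α z))) =
      cechCap (ν.isCompact_cores.image continuous_incl).isClosed h
        (HomologicalOrientation.classAlong (Nat.le_add_left 1 n) (ExtCollar.orientation z hz)
          (ν.isCompact_cores.image continuous_incl))
        (Cech.of ℤ (SimplexSpan.coefR ℤ) (OpenNhd.univ (incl n '' ν.cores))
          (subsetCochains.thetaInv p (singularCohomology.map ℤ ℤ baseCM p α))) := by
  have hS'c : IsCompact (incl n '' ν.cores : Set (ExtCollar n W)) := ν.isCompact_cores.image continuous_incl
  have hS'K : (incl n '' ν.cores : Set (ExtCollar n W)) ⊆ range (incl n) := image_subset_range _ _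
  rw [ν.map_incl_map_id_eq_restrictLocal hkl q]
  -- `Φ (α ⌢ z) = base^* α ⌢ Φ z`
  have h1 : (toExtCollar ℤ ℤ q).hom (relCapProduct (M := ℤ) ((𝓡∂ (n + 1)).boundary W) h α z) =
      relCapProduct (M := ℤ) (range (incl n))ᶜ h (singularCohomology.map ℤ ℤ baseCM p α)
        ((toExtCollar ℤ ℤ (n + 1)).hom z) := by
    rw [ExtCollar.relCapProduct_eq_toExtCollar_inv h α z, Iso.inv_hom_id_apply]
  rw [h1]
  -- the projection formula for `𝟙 : (X, X ∖ K) → (X, X ∖ incl S)`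
  have h2 : restrictLocal ℤ ℤ hS'K q (relCapProduct (M := ℤ) (range (incl n))ᶜ h
        (singularCohomology.map ℤ ℤ baseCM p α) ((toExtCollar ℤ ℤ (n + 1)).hom z)) =
      relCapProduct (M := ℤ) (incl n '' ν.cores)ᶜ h (singularCohomology.map ℤ ℤ baseCM p α)
        (restrictLocal ℤ ℤ hS'K (n + 1) ((toExtCollar ℤ ℤ (n + 1)).hom z)) := by
    have := relativeSingularHomology.map_relCapProduct (M := ℤ) (ContinuousMap.id (ExtCollar n W))
      (fun _ hx => Set.compl_subset_compl.2 hS'K hx : MapsTo (ContinuousMap.id (ExtCollar n W))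
        (range (incl n))ᶜ (incl n '' ν.cores)ᶜ) h
      (singularCohomology.map ℤ ℤ baseCM p α) ((toExtCollar ℤ ℤ (n + 1)).hom z)
    rw [singularCohomology.map_id, ModuleCat.id_apply] at this
    exact this
  rw [h2, ← cechCap_of_univ_thetaInv hS'c.isClosed h]
  -- `(Φ z)|_{incl S}` is `[X]_{incl S}`
  have h3 : (relativeSingularHomology.concreteIso ℤ ℤ (ExtCollar n W) (incl n '' ν.cores)ᶜ (n + 1)).hom
      (restrictLocal ℤ ℤ hS'K (n + 1) ((toExtCollar ℤ ℤ (n + 1)).hom z)) =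
      HomologicalOrientation.classAlong (Nat.le_add_left 1 n) (ExtCollar.orientation z hz) hS'c := by
    rw [← HomologicalOrientation.res_classAlong (Nat.le_add_left 1 n) (ExtCollar.orientation z hz)
      isCompact_range_incl hS'c hS'K, ExtCollar.classAlong_orientation_eq z hz,
      ← localHomologyOfSet.cmpIso_hom_eq_concreteIso_hom, ← localHomologyOfSet.cmpIso_hom_eq_concreteIso_hom]
    change _ = ((localHomologyOfSet.cmpIso ℤ ℤ (ExtCollar n W) (range (incl n)) (n + 1)).hom ≫
      clocalHomology.res ℤ ℤ (ExtCollar n W) hS'K (n + 1)) ((toExtCollar ℤ ℤ (n + 1)).hom z)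
    rw [localHomologyOfSet.cmpIso_hom_comp_res]
    rfl
  rw [h3]

/-! ### Kervaire–Milnor's duality sentence: `λ` is primitive -/

/-- **`⟨(α|_S) ∘ e, c⟩ = ⟨α, λ_c⟩`**: the Čech class `Θ⁻¹(base^* α)` over the core, read on `Sᵏ`
through the tautness map `Ȟᵏ(incl S) → Hᵏ(incl S)` and a parametrisation `e : Sᵏ ≅ incl S` of the
core by `u ↦ incl φ(u, 0)`, pairs with `c ∈ H_k(Sᵏ)` as `α` pairs with `(ν.sphereMap)⁎ c`
(naturality of the Kronecker pairing, Hatcher p. 201). [cite: HatcherAT2002, §3.1 p. 201] -/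
theorem kroneckerPairing_cechClass_eq [T2Space W]
    (e : (𝕊 k) ≃ₜ ↥(incl n '' ν.cores : Set (ExtCollar n W)))
    (he : ∀ u, ((e u : ↥(incl n '' ν.cores)) : ExtCollar n W) = incl n (ν.toFun () (u, 0)))
    (α : singularCohomology ℤ ℤ W k) (c : singularHomology ℤ ℤ (𝕊 k) k) :
    kroneckerPairing ℤ ℤ (𝕊 k) k (singularCohomology.map ℤ ℤ (e : C(𝕊 k, ↥(incl n '' ν.cores))) k
        (Cech.toSingularCohomology ℤ (incl n '' ν.cores) k
          (Cech.of ℤ (SimplexSpan.coefR ℤ) (OpenNhd.univ (incl n '' ν.cores))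
            (subsetCochains.thetaInv k (singularCohomology.map ℤ ℤ baseCM k α))))) c =
      kroneckerPairing ℤ ℤ W k α (singularHomology.map ℤ ℤ ν.sphereMap k c) := by
  have h0 : Cech.toSubset ℤ (ModuleCat.of ℤ (ULift.{0} ℤ)) (incl n '' ν.cores) k
      (Cech.of ℤ (SimplexSpan.coefR ℤ) (OpenNhd.univ (incl n '' ν.cores))
        (subsetCochains.thetaInv k (singularCohomology.map ℤ ℤ baseCM k α))) =
      subsetCochains.resH (subset_univ (incl n '' ν.cores : Set (ExtCollar n W))) k
        (subsetCochains.thetaInv k (singularCohomology.map ℤ ℤ baseCM k α)) := by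
    rw [Cech.toSubset_of]
    rfl
  have h1 : Cech.toSingularCohomology ℤ (incl n '' ν.cores) k
      (Cech.of ℤ (SimplexSpan.coefR ℤ) (OpenNhd.univ (incl n '' ν.cores))
        (subsetCochains.thetaInv k (singularCohomology.map ℤ ℤ baseCM k α))) =
      singularCohomology.map ℤ ℤ (⟨Subtype.val, continuous_subtype_val⟩ :
        C(↥(incl n '' ν.cores : Set (ExtCollar n W)), ExtCollar n W)) k
        (singularCohomology.map ℤ ℤ baseCM k α) := by
    change (subsetCochains.homologyIsoSingularCohomology ℤ (incl n '' ν.cores) k).hom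
      (Cech.toSubset ℤ (ModuleCat.of ℤ (ULift.{0} ℤ)) (incl n '' ν.cores) k _) = _
    rw [h0, subsetCochains.homologyIsoSingularCohomology_hom_resH,
      subsetCochains.homologyIsoSingularCohomology_hom_thetaInv, ← ModuleCat.comp_apply,
      ← singularCohomology.map_comp]
    rfl
  rw [h1, ← ModuleCat.comp_apply, ← singularCohomology.map_comp, ← ModuleCat.comp_apply,
    ← singularCohomology.map_comp, kroneckerPairing_map]
  have h2 : baseCM.comp ((⟨Subtype.val, continuous_subtype_val⟩ :
      C(↥(incl n '' ν.cores : Set (ExtCollar n W)), ExtCollar n W)).comp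
        (e : C(𝕊 k, ↥(incl n '' ν.cores)))) = ν.sphereMap := by
    ext u
    change base ((e u : ↥(incl n '' ν.cores)) : ExtCollar n W) = ν.toFun () (u, 0)
    rw [he, base_incl]
  rw [h2]

/-- **"`μ₁ · λ = d`"** (the duality computation of Kervaire–Milnor 1963, p. 516, proof of Lemma
5.7, for any value of the functional): if `f((ν.sphereMap)⁎ θ) = d` for a homomorphism
`f : H_k(W; ℤ) → ℤ` (W compact, simply connected, `k + l = n`, `k ≥ 2`, `H_l(∂W) = 0`), then
**`d • H_{l+1}(W, W ∖ S) ⊆ im (H_{l+1}(W) → H_{l+1}(W, W ∖ S))`**: every `d • y` lifts to `H_{l+1}(W)`.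
(`f = ⟨α, -⟩` by universal coefficients; `μ₁ = α ⌢ z` lifts to `H_{l+1}(W)` since `H_l(∂W) = 0`;
its image in `H_{l+1}(W | S)` is `α|_S ⌢ [X]_S` with `α|_S` pairing to `d` with `[S]`, and every
Čech class `b` of the core has `d • b = (L b) • α|_S`; Čech–Poincaré duality along the core.)
[cite: KervaireMilnorAnnals1963, p. 516, proof of Lemma 5.7] [cite: Miller2020, Thm. 37.1] -/
theorem exists_ofAbsolute_eq_zsmul_of_exists_dual [T2Space W] [CompactSpace W]
    [IsManifold (𝓡∂ (n + 1)) ∞ W] [SimplyConnectedSpace W] (hkl : k + l = n) (hk : 2 ≤ k)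
    (hbd : IsZero (singularHomology ℤ ℤ ↥((𝓡∂ (n + 1)).boundary W) l))
    {θ : singularHomology ℤ ℤ (𝕊 k) k} (hθ : zmultiples θ = ⊤) {d : ℤ}
    (hdual : ∃ f : singularHomology ℤ ℤ W k →+ ℤ, f (singularHomology.map ℤ ℤ ν.sphereMap k θ) = d)
    (y : relativeSingularHomology ℤ ℤ W (ν.complement : Set W) (l + 1)) :
    ∃ x, relativeSingularHomology.ofAbsolute ℤ ℤ W (ν.complement : Set W) (l + 1) x = d • y := by
  classical
  obtain ⟨f, hf⟩ := hdual
  have hdeg : k + (l + 1) = n + 1 := by omega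
  have hS'c : IsCompact (incl n '' ν.cores : Set (ExtCollar n W)) := ν.isCompact_cores.image continuous_incl
  -- (1) the relative fundamental class of `(W, ∂W)` and the orientation of the external collar
  obtain ⟨z, hz⟩ := exists_isRelFundamentalClass_of_simplyConnectedSpace n W
  -- (2) universal coefficients: `α ∈ Hᵏ(W)` with `⟨α, -⟩ = f`
  let fL : singularHomology ℤ ℤ W k →ₗ[ℤ] ℤ :=
    { toFun := f
      map_add' := fun x y => f.map_add x y
      map_smul' := fun c x => by
        simpa only [Int.cast_id, RingHom.id_apply] using map_intCast_smul f ℤ ℤ c x }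
  obtain ⟨α, hα⟩ := kroneckerPairing_surjective ℤ W k fL
  have hαθ : kroneckerPairing ℤ ℤ W k α (singularHomology.map ℤ ℤ ν.sphereMap k θ) = d := by
    rw [hα]; exact hf
  -- (3) `μ₁ = α ⌢ z ∈ H_{l+1}(W, ∂W)` and the pieces of the diagram
  set μ₁ := relCapProduct (M := ℤ) ((𝓡∂ (n + 1)).boundary W) hdeg α z with hμ₁
  set jS := relativeSingularHomology.map ℤ ℤ (ContinuousMap.id W) (ν.mapsTo_id_boundary_compl_cores hkl)
    (l + 1) with hjS
  set E := relativeSingularHomology.map ℤ ℤ (inclCM n) ν.mapsTo_incl_compl_cores (l + 1) with hE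
  haveI : IsIso E := ν.isIso_map_incl_compl_cores hkl (l + 1)
  set cI := relativeSingularHomology.concreteIso ℤ ℤ (ExtCollar n W) (incl n '' ν.cores)ᶜ (l + 1) with hcI
  -- tautness of the core and `Sᵏ ≅ incl S`
  obtain ⟨T⟩ := ν.nonempty_retractionNhds_image_cores hkl
  obtain ⟨e, he⟩ := ν.exists_homeomorph_sphere_image_cores (n := n)
  -- the Čech class `a = Θ⁻¹(base^* α)` over the core, and the functional `L = ⟨e^*(-)|, θ⟩`
  set aS : Cech ℤ (ModuleCat.of ℤ (ULift.{0} ℤ)) (incl n '' ν.cores : Set (ExtCollar n W)) k :=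
    Cech.of ℤ (SimplexSpan.coefR ℤ) (OpenNhd.univ (incl n '' ν.cores))
      (subsetCochains.thetaInv k (singularCohomology.map ℤ ℤ baseCM k α)) with haS
  let L : Cech ℤ (ModuleCat.of ℤ (ULift.{0} ℤ)) (incl n '' ν.cores : Set (ExtCollar n W)) k → ℤ :=
    fun b => kroneckerPairing ℤ ℤ (𝕊 k) k (singularCohomology.map ℤ ℤ
      (e : C(𝕊 k, ↥(incl n '' ν.cores))) k (Cech.toSingularCohomology ℤ (incl n '' ν.cores) k b)) θ
  have hL : ∀ b, L b = kroneckerPairing ℤ ℤ (𝕊 k) k (singularCohomology.map ℤ ℤ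
      (e : C(𝕊 k, ↥(incl n '' ν.cores))) k (Cech.toSingularCohomology ℤ (incl n '' ν.cores) k b)) θ :=
    fun b => rfl
  -- `L a = ⟨α, λ⟩ = d`
  have haL : L aS = d := by rw [hL, haS, ν.kroneckerPairing_cechClass_eq e he α θ]; exact hαθ
  change relativeSingularHomology ℤ ℤ W ν.coresᶜ (l + 1) at y
  -- Čech duality along the core: `E y = b ⌢ [X]_S` for some `b ∈ Ȟᵏ(incl S)`, and `d • b = L b • a`
  obtain ⟨b, hb⟩ := (HomologicalOrientation.bijective_cechCap_classAlong (Nat.le_add_left 1 n)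
    (ExtCollar.orientation z hz) hS'c hdeg).2 (cI.hom (E y))
  have hbS : d • b = L b • aS := Cech.zsmul_eq_zsmul_of_sphere T hk e hθ L hL haL b
  -- hence `E (d • y) = E (j_S (L b • μ₁))`
  have hμ : cI.hom (E (jS μ₁)) = cechCap hS'c.isClosed hdeg
      (HomologicalOrientation.classAlong (Nat.le_add_left 1 n) (ExtCollar.orientation z hz) hS'c) aS :=
    ν.concreteIso_map_incl_relCapProduct hkl hdeg z hz α
  have hy : E (d • y) = E (jS (L b • μ₁)) := by
    apply ((forget (ModuleCat ℤ)).mapIso cI).toEquiv.injective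
    change cI.hom (E (d • y)) = cI.hom (E (jS (L b • μ₁)))
    rw [map_zsmul, map_zsmul, ← hb, ← map_zsmul, hbS, map_zsmul, map_zsmul, map_zsmul, map_zsmul, hμ]
  have hy' : d • y = jS (L b • μ₁) := (ModuleCat.mono_iff_injective E).1 inferInstance hy
  -- (4) `H_l(∂W) = 0`: lift `L b • μ₁` to `H_{l+1}(W)`
  have hex := (ShortComplex.moduleCat_exact_iff _).1
    (relativeSingularHomology.exact_ofAbsolute_δ ℤ ℤ ((𝓡∂ (n + 1)).boundary W) l)
  haveI := ModuleCat.subsingleton_of_isZero hbd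
  obtain ⟨x, hx⟩ := hex (L b • μ₁) (Subsingleton.elim _ _)
  refine ⟨x, ?_⟩
  change (relativeSingularHomology.ofAbsolute ℤ ℤ W ν.coresᶜ (l + 1)) x = d • y
  rw [hy', ← hx]
  change _ = (relativeSingularHomology.ofAbsolute ℤ ℤ W ((𝓡∂ (n + 1)).boundary W) (l + 1) ≫ jS) x
  rw [hjS, relativeSingularHomology.ofAbsolute_comp_map, singularHomology.map_id]
  rfl

/-- **A sphere class generating a free direct summand is primitive** (Kervaire–Milnor 1963,
p. 516, proof of Lemma 5.7: "Using the Poincaré duality theorem one sees that there exists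
`μ₁ ∈ H_{k+1}(M, bM)` with `μ₁ · λ = 1`. Since `H_k(bM) = 0`, `H_{k+1}M → H_{k+1}(M, bM)` is onto
… Thus `λ` is primitive"). For a framed sphere `ν : Sᵏ × ℝˡ⁺¹ ↪ W` (`k + l = n`, `k ≥ 2`) in a
compact simply connected smooth `(n+1)`-manifold with boundary `W` with `H_l(∂W; ℤ) = 0`, a
generator `θ` of `H_k(Sᵏ; ℤ)` and a homomorphism `f : H_k(W; ℤ) → ℤ` with `f((ν.sphereMap)⁎ θ) = 1`:
`j⁎ : H_{l+1}(W; ℤ) → H_{l+1}(W, W ∖ S; ℤ)` is onto, `S` the core sphere — the homological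
primitivity consumed by the surgery lemmas (`exists_ofAbsolute_eq_zsmul_of_exists_dual`, `d = 1`).
[cite: KervaireMilnorAnnals1963, p. 516, proof of Lemma 5.7] -/
theorem epi_ofAbsolute_complement_of_exists_dual [T2Space W] [CompactSpace W]
    [IsManifold (𝓡∂ (n + 1)) ∞ W] [SimplyConnectedSpace W] (hkl : k + l = n) (hk : 2 ≤ k)
    (hbd : IsZero (singularHomology ℤ ℤ ↥((𝓡∂ (n + 1)).boundary W) l))
    {θ : singularHomology ℤ ℤ (𝕊 k) k} (hθ : zmultiples θ = ⊤)
    (hdual : ∃ f : singularHomology ℤ ℤ W k →+ ℤ, f (singularHomology.map ℤ ℤ ν.sphereMap k θ) = 1) :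
    Epi (relativeSingularHomology.ofAbsolute ℤ ℤ W (ν.complement : Set W) (l + 1)) := by
  rw [ModuleCat.epi_iff_surjective]
  intro y
  obtain ⟨x, hx⟩ := ν.exists_ofAbsolute_eq_zsmul_of_exists_dual hkl hk hbd hθ hdual y
  exact ⟨x, by rw [hx, one_smul]⟩

end FramedSphereFamily

/-- **Kervaire–Milnor's duality sentence in their setting** (p. 516: `M` compact, simply
connected, `bM` a homotopy sphere; "Since `H_k(bM) = 0` …"): for a null-cobordism `W` of a homotopy
`n`-sphere with `W` simply connected, a framed sphere `ν : Sᵏ × ℝˡ⁺¹ ↪ W` (`k + l = n`, `k ≥ 2`,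
`0 < l < n`), a generator `θ` of `H_k(Sᵏ; ℤ)` and `f : H_k(W; ℤ) → ℤ` with `f((ν.sphereMap)⁎ θ) = 1`,
the map `H_{l+1}(W; ℤ) → H_{l+1}(W, W ∖ S; ℤ)` is onto (`H_l(bW) = H_l(Sⁿ) = 0`, Hatcher Cor. 2.14,
and `FramedSphereFamily.epi_ofAbsolute_complement_of_exists_dual`).
[cite: KervaireMilnorAnnals1963, p. 516, proof of Lemma 5.7] [cite: HatcherAT2002, Cor. 2.14] -/
theorem NullCobordism.epi_ofAbsolute_complement_of_exists_dual {n k l : ℕ} (S : HomotopySphere n)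
    (c : NullCobordism.{0} n S.carrier) [SimplyConnectedSpace c.W]
    (ν : FramedSphereFamily (𝓡∂ (n + 1)) c.W Unit k (l + 1)) (hkl : k + l = n) (hk : 2 ≤ k)
    (hl0 : l ≠ 0) (hln : l ≠ n)
    {θ : singularHomology ℤ ℤ (𝕊 k) k} (hθ : zmultiples θ = ⊤)
    (hdual : ∃ f : singularHomology ℤ ℤ c.W k →+ ℤ, f (singularHomology.map ℤ ℤ ν.sphereMap k θ) = 1) :
    Epi (relativeSingularHomology.ofAbsolute ℤ ℤ c.W (ν.complement : Set c.W) (l + 1)) := by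
  -- `∂W ≅ Σ ≃ Sⁿ`, so `H_l(∂W) = 0`
  let e : ↥((𝓡∂ (n + 1)).boundary c.W) ≃ₜ S.carrier :=
    (c.isSmoothEmbedding_incl.isEmbedding.toHomeomorph.trans (Homeomorph.setCongr c.range_incl)).symm
  have hbd : IsZero (singularHomology ℤ ℤ ↥((𝓡∂ (n + 1)).boundary c.W) l) :=
    (isZero_singularHomology_sphere_holds ℤ ℤ hl0 hln).of_iso
      (singularHomology.isoOfHomotopyEquiv ℤ ℤ
        (e.toHomotopyEquiv.trans S.nonempty_homotopyEquiv.some) l)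
  exact ν.epi_ofAbsolute_complement_of_exists_dual hkl hk hbd hθ hdual

end Literature.Topology.FourManifolds

end
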